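import Literature.Analysis.FluidPDE.StationaryEulerStep
import HarnessLib

/-!
# Route TaylorCertificates — support `ForcedStandingFlows`: the perturbation step for affine subsolutions

Helper file for the item `stmt-AnomalousDissipation-14031` (`ForcedStandingFlows`, the forced
stationary Euler `h`-principle on `T³`). The tree proves Choffrut–Székelyhidi 2014, Thm. 1
(`Literature.Analysis.FluidPDE.StationaryEuler.*`) by an explicit convex-integration iteration
whose perturbation step `StationaryEuler.step` is stated for fields of the space `X₀` (`MemX0`):
smooth, values in the relaxed sets `𝒰_{e(x)}`, **and** satisfying the HOMOGENEOUS weak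
subsolution identities `IsTorusSub`. The forced problem starts from an AFFINE strict subsolution
(`div u + ∇q = f`), for which `IsTorusSub` fails; but the step never uses that field. This file
re-runs the step (§2, Step 3 of the paper, verbatim the tree's proof) under the two hypotheses it
actually consumes — smoothness and pointwise membership — and additionally exports the exact
vanishing of all coordinate means of the increment (grid fields are cellwise mean zero), which the
forced assembly needs for the zero-mean clause. The `H⁻¹` clause of the tree's step is not needed
here and is dropped.

## References

* A. Choffrut, L. Székelyhidi Jr., *Weak solutions to the stationary incompressible Euler
  equations*, SIAM J. Math. Anal. 46 (2014) 4060–4074 = arXiv:1401.4301, §2, Step 3; Cor. 16.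
-/

noncomputable section

open scoped InnerProductSpace ContDiff ENNReal
open Set Function MeasureTheory Metric
open Literature.Analysis.FunctionSpaces Literature.Analysis.FluidPDE
open Literature.Analysis.FluidPDE.StationaryEuler

namespace Summit.AnomalousDissipation.AnomalousDissipation.Theorems

-- the mandated namespace `Summit.<Summit>.<Problem>.Theorems` repeats `AnomalousDissipation` (single-problem summit)
set_option linter.dupNamespace false

namespace ForcedFlows

variable {d : Type*} [Fintype d] [DecidableEq d] [Nonempty d]

/-! ## Pointwise data -/

/-- **Pointwise perturbation data** at a point `x₀` of a smooth field with values in the relaxed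
sets (the tree's `StationaryEuler.exists_pointData` with the hypothesis `MemX0` weakened to
pointwise membership, which is all its proof uses): a packet supported in the axis cube whose
values keep `w(x₀)` in `𝒰_{e(x₀)}` with a uniform joint margin `δ`, and whose energy is at least
`e(x₀) - |v(x₀)|² - η`. [cite: ChoffrutSzekelyhidi2014, §2, Step 3; Cor. 16] -/
theorem exists_pointData' (𝓕 : RelaxedFamily d) {e : UnitAddTorus d → ℝ} {w : UnitAddTorus d → State d}
    (hwm : ∀ x, w x ∈ 𝓕.U (e x)) {η : ℝ} (hη : 0 < η) (x₀ : UnitAddTorus d) :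
    ∃ (P : Packet d) (δ : ℝ), 0 < δ ∧ Packet.SuppIn (box d) P ∧
      (∀ r' w', |r' - e x₀| < δ → IsAdm w' → ∀ y, dist w' (w x₀ + Packet.field P y) < δ → w' ∈ 𝓕.U r') ∧
      (∀ r' w', |r' - e x₀| < δ → IsAdm w' → dist w' (w x₀) < δ → w' ∈ 𝓕.U r') ∧
      e x₀ - ‖vel (w x₀)‖ ^ 2 - η ≤ ∫ y, ‖Packet.field P y‖ ^ 2 := by
  have hη3 : 0 < η / 3 := by positivity
  obtain ⟨r', -, -, -, T, hT, hbary, -, hgain⟩ := 𝓕.exists_laminate_var_ge (hwm x₀) hη3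
  obtain ⟨i₀⟩ := ‹Nonempty d›
  obtain ⟨P, hPsupp, hPU, hPgain⟩ := realize i₀ (𝓕.isRelOpen (e x₀)) (fun w hw => 𝓕.isAdm_of_mem hw) T hT hη3
  obtain ⟨P', hP'supp, hP'vals, hP'gain⟩ := exists_boxed (T.frame i₀) hPsupp hη3
  -- the compact set of values and its joint margin
  set S : Set (State d) := insert (w x₀) (range fun y => w x₀ + Packet.field P' y) with hS
  have hrange : (range fun y => w x₀ + Packet.field P' y) = (fun z => w x₀ + z) '' range (Packet.field P') :=
    Set.range_comp (fun z => w x₀ + z) (Packet.field P')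
  have hSc : IsCompact S := by
    rw [hS, hrange]
    exact ((isCompact_range_field P').image (continuous_const.add continuous_id)).insert (w x₀)
  have hSU : S ⊆ 𝓕.U (e x₀) := by
    rintro s (rfl | ⟨y, rfl⟩)
    · exact hwm x₀
    · show w x₀ + Packet.field P' y ∈ 𝓕.U (e x₀)
      rcases hP'vals y with h0 | ⟨z, hz⟩
      · rw [h0, add_zero]; exact hwm x₀
      · rw [hz, ← hbary]; exact hPU z
  obtain ⟨δ, hδ, hmarg⟩ := 𝓕.exists_jmargin hSc hSU
  refine ⟨P', δ, hδ, hP'supp, fun r' w' hr hw' y hd => hmarg _ (mem_insert_of_mem _ ⟨y, rfl⟩) r' w' hr hw' hd,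
    fun r' w' hr hw' hd => hmarg _ (mem_insert _ _) r' w' hr hw' hd, ?_⟩
  rw [hbary] at hPgain
  linarith

/-! ## The step -/

omit [Nonempty d] in
/-- The coordinate means of a grid field vanish exactly (cellwise mean zero, summed over the cells
of the fundamental cube). [folklore] -/
theorem integral_gridField_apply_eq_zero {m : ℕ} (hm : 0 < m) {Q : (d → ℤ) → Packet d}
    (hQ : ∀ κ, Packet.SuppIn (box d) (Q κ)) (c : Idx d) : ∫ x, gridField hm Q x c = 0 := by
  have hc : Continuous fun x => gridField hm Q x c :=
    (PiLp.continuous_apply 2 (fun _ : Idx d => ℝ) c).comp (Packet.continuous_tfield (suppIn_gridPacket hm hQ))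
  rw [integral_eq_sum_cells hm hc]
  exact Finset.sum_eq_zero fun κ _ => setIntegral_cell_gridField_apply hm hQ κ c

/-- **The perturbation step for smooth fields with values in the relaxed sets** (§2, Step 3 of the
paper in the explicit form of the tree's `StationaryEuler.step`, with `MemX0` weakened to
smoothness + pointwise membership, and with exact coordinate means). For such `w`, finitely many
continuous test fields `p_a` and `ε > 0` there is a smooth weak (homogeneous) subsolution `W` with
`w + W` valued in `𝒰_{e(x)}`, `|∫ ⟪W, p_a⟫| ≤ ε`, `∫ W_c = 0` for every coordinate `c`, and
`∫ ‖W‖² ≥ J(w) - ε`. [cite: ChoffrutSzekelyhidi2014, §2, Step 3] -/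
theorem step' (𝓕 : RelaxedFamily d) {e : UnitAddTorus d → ℝ} (he : Continuous e) {w : UnitAddTorus d → State d}
    (hws : Torus.IsSmooth w) (hwm : ∀ x, w x ∈ 𝓕.U (e x)) {N : ℕ} (p : Fin N → UnitAddTorus d → State d)
    (hp : ∀ a, Continuous (p a)) {ε : ℝ} (hε : 0 < ε) :
    ∃ W : UnitAddTorus d → State d, Torus.IsSmooth W ∧ IsTorusSub W ∧ (∀ x, w x + W x ∈ 𝓕.U (e x)) ∧
      (∀ a, |∫ x, ⟪W x, p a x⟫_ℝ| ≤ ε) ∧ (∀ c, ∫ x, W x c = 0) ∧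
      defect e w - ε ≤ ∫ x, ‖W x‖ ^ 2 := by
  have hε4 : 0 < ε / 4 := by positivity
  -- Step 1: pointwise data
  choose Pk δk hδk hPk_supp hPk_marg hPk_marg0 hPk_gain using fun x₀ => exists_pointData' 𝓕 hwm hε4 x₀
  -- the defect density
  set g : UnitAddTorus d → ℝ := fun x => e x - ‖vel (w x)‖ ^ 2 with hg
  have hwc : Continuous w := hws.continuous
  have hgc : Continuous g := he.sub ((continuous_norm.comp ((continuous_vel).comp hwc)).pow 2)
  -- Step 2: the open cover of the torus and a finite subcover
  set O : UnitAddTorus d → Set (UnitAddTorus d) := fun a =>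
    {x | |e x - e a| < δk a / 2 ∧ dist (w x) (w a) < δk a / 2 ∧ |g x - g a| < ε / 4} with hO
  have hOo : ∀ a, IsOpen (O a) := fun a =>
    IsOpen.inter (isOpen_lt (continuous_abs.comp (he.sub continuous_const)) continuous_const)
      (IsOpen.inter (isOpen_lt (hwc.dist continuous_const) continuous_const)
        (isOpen_lt (continuous_abs.comp (hgc.sub continuous_const)) continuous_const))
  have hOmem : ∀ a, a ∈ O a := fun a => by
    simp only [hO, mem_setOf_eq, sub_self, abs_zero, dist_self]
    exact ⟨half_pos (hδk a), half_pos (hδk a), hε4⟩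
  obtain ⟨t, ht⟩ := isCompact_univ.elim_finite_subcover O hOo fun x _ => mem_iUnion.2 ⟨x, hOmem x⟩
  -- common bound of the finitely many reference fields
  have hbd : ∀ a, ∃ B, ∀ y, ‖Packet.field (Pk a) y‖ ≤ B := fun a => by
    obtain ⟨B, hB⟩ := (isCompact_range_field (Pk a)).isBounded.exists_norm_le
    exact ⟨B, fun y => hB _ ⟨y, rfl⟩⟩
  choose B hB using hbd
  obtain ⟨M, hM0, hM⟩ := exists_common_bound t B
  have hMt : ∀ a ∈ t, ∀ y, ‖Packet.field (Pk a) y‖ ≤ M := fun a ha y => (hB a y).trans (hM a ha)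
  -- Step 3: Lebesgue number of the pulled-back cover on the closed ball containing the cube
  set Kb : Set (Ed d) := closedBall (0 : Ed d) (Fintype.card d) with hKb
  have hKc : IsCompact Kb := isCompact_closedBall _ _
  obtain ⟨lam, hlam, hleb⟩ := lebesgue_number_lemma_of_metric hKc (c := fun a : t => Torus.proj ⁻¹' O a)
    (fun a => (hOo a).preimage Torus.continuous_proj) (fun y _ => by
      have := ht (mem_univ (Torus.proj y))
      simp only [mem_iUnion] at this
      obtain ⟨a, ha, hya⟩ := this
      exact mem_iUnion.2 ⟨⟨a, ha⟩, hya⟩)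
  obtain ⟨x₀⟩ : Nonempty (UnitAddTorus d) := inferInstance
  obtain ⟨a₀, ha₀⟩ : ∃ a, a ∈ t := by
    have := ht (mem_univ x₀)
    simp only [mem_iUnion] at this
    obtain ⟨a, ha, -⟩ := this
    exact ⟨a, ha⟩
  haveI : Nonempty t := ⟨⟨a₀, ha₀⟩⟩
  choose! sel hsel using hleb
  -- Step 4: the mesh
  -- (a) Lebesgue: `√d / m < lam`
  obtain ⟨m₁, hm₁⟩ := exists_nat_gt (Real.sqrt (Fintype.card d) / lam)
  -- (b) oscillation of the test fields
  set η : ℝ := ε / (Fintype.card (Idx d) * M + 1) with hη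
  have hη0 : 0 < η := by positivity
  have hosc : ∀ ac : Fin N × Idx d, ∃ m₀ : ℕ, 0 < m₀ ∧ ∀ m : ℕ, m₀ ≤ m → ∀ κ : d → Fin m,
      ∀ y ∈ Torus.latticeCell m (gridIdx κ), ∀ y' ∈ Torus.latticeCell m (gridIdx κ),
        |p ac.1 (Torus.proj y) ac.2 - p ac.1 (Torus.proj y') ac.2| ≤ η := fun ac =>
    exists_mesh_osc_le ((PiLp.continuous_apply 2 (fun _ : Idx d => ℝ) ac.2).comp (hp ac.1)) hη0
  choose m₂ hm₂pos hm₂ using hosc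
  set m : ℕ := m₁ + (Finset.univ.sup m₂) + 1 with hmdef
  have hm : 0 < m := by positivity
  have hm' : (0 : ℝ) < m := by exact_mod_cast hm
  have hm_ge₁ : m₁ ≤ m := by omega
  have hm_ge₂ : ∀ ac, m₂ ac ≤ m := fun ac => by
    have : m₂ ac ≤ Finset.univ.sup m₂ := Finset.le_sup (Finset.mem_univ ac)
    omega
  have hmesh : Real.sqrt (Fintype.card d) / m < lam := by
    have h1 : Real.sqrt (Fintype.card d) / lam < m := lt_of_lt_of_le hm₁ (by exact_mod_cast hm_ge₁)
    rw [div_lt_iff₀ hlam] at h1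
    rw [div_lt_iff₀ hm']; linarith
  -- Step 5: the reference packets of the cells and the increment
  set Q : (d → ℤ) → Packet d := fun κ => Pk (sel (corner frame0 m κ)) with hQ
  have hQsupp : ∀ κ, Packet.SuppIn (box d) (Q κ) := fun κ => hPk_supp _
  -- cells are small: the cell `κ` is mapped into `O (sel (corner κ))`, and `sel (corner κ) ∈ t`
  have hcorner : ∀ κ : d → Fin m, corner frame0 m (gridIdx κ) ∈ Kb := fun κ =>
    Torus.unitCube_subset_closedBall (Torus.latticeCell_subset_unitCube hm κ (corner_mem_latticeCell hm κ))
  have hsel_t : ∀ κ : d → Fin m, (sel (corner frame0 m (gridIdx κ)) : UnitAddTorus d) ∈ t := fun κ =>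
    (sel (corner frame0 m (gridIdx κ))).2
  have hcellO : ∀ κ : d → Fin m, ∀ y ∈ Torus.latticeCell m (gridIdx κ),
      Torus.proj y ∈ O (sel (corner frame0 m (gridIdx κ))) := by
    intro κ y hy
    have hball := hsel (corner frame0 m (gridIdx κ)) (hcorner κ)
    refine hball (mem_ball.2 ?_)
    rw [dist_eq_norm]
    exact lt_of_le_of_lt (Torus.norm_sub_le_of_mem_latticeCell hm (corner_mem_latticeCell hm κ) hy) hmesh
  have hQM : ∀ κ y, ‖Packet.field (Q κ) y‖ ≤ M := fun κ y => hMt _ (sel (corner frame0 m κ)).2 y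
  set W : UnitAddTorus d → State d := gridField hm Q with hW
  refine ⟨W, isSmooth_gridField hm hQsupp, isTorusSub_gridField hm hQsupp, fun x => ?_, fun a => ?_,
    fun c => integral_gridField_apply_eq_zero hm hQsupp c, ?_⟩
  · -- membership `w x + W x ∈ 𝒰_{e x}`
    set y := Torus.repr x with hy
    have hyU : y ∈ Torus.unitCube d := Torus.repr_mem_unitCube x
    have hxy : Torus.proj y = x := Torus.proj_repr x
    obtain ⟨κ, hyκ⟩ : ∃ κ : d → Fin m, y ∈ Torus.latticeCell m (gridIdx κ) := by
      have := Torus.unitCube_eq_iUnion_latticeCell (d := d) hm ▸ hyU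
      rw [mem_iUnion] at this
      exact this
    set a := sel (corner frame0 m (gridIdx κ)) with ha
    have hxO : x ∈ O a := hxy ▸ hcellO κ y hyκ
    obtain ⟨hex, hwx, -⟩ := hxO
    have hadm : IsAdm (w x + W x) := (𝓕.isAdm_of_mem (hwm x)).add (isAdm_gridField hm hQsupp x)
    have hWx : W x = Packet.field (gridPacket hm Q) y := by rw [hW, ← hxy, gridField_proj hm hQsupp hyU]
    by_cases hyo : y ∈ Torus.latticeCellInterior m (gridIdx κ)
    · have hval : W x = Packet.field (Pk a) ((m : ℝ) • (y - corner frame0 m (gridIdx κ))) := by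
        rw [hWx, field_gridPacket_of_mem hm hQsupp hyo]
      refine hPk_marg a (e x) _ (by linarith [hδk a]) hadm ((m : ℝ) • (y - corner frame0 m (gridIdx κ))) ?_
      rw [hval, dist_eq_norm, add_sub_add_right_eq_sub, ← dist_eq_norm]
      linarith [hδk a]
    · have hval : W x = 0 := by
        rw [hWx]
        refine field_gridPacket_eq_zero hm hQsupp fun κ' hκ' => ?_
        by_cases hκκ : κ' = κ
        · exact hyo (hκκ ▸ hκ')
        · exact (Torus.disjoint_latticeCell hm (gridIdx_injective.ne hκκ)).ne_of_mem
            (Torus.latticeCellInterior_subset hκ') hyκ rfl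
      refine hPk_marg0 a (e x) _ (by linarith [hδk a]) hadm ?_
      rw [hval, add_zero]
      linarith [hδk a]
  · -- near-orthogonality
    have hpc : Continuous (p a) := hp a
    have h := abs_integral_inner_gridField_le hm hQsupp hM0 hQM hpc fun c κ y hy y' hy' =>
      hm₂ (a, c) m (hm_ge₂ (a, c)) κ y hy y' hy'
    refine h.trans ?_
    have hden : 0 < (Fintype.card (Idx d) : ℝ) * M + 1 := by positivity
    calc (Fintype.card (Idx d) : ℝ) * (M * η) = ε * ((Fintype.card (Idx d) : ℝ) * M / ((Fintype.card (Idx d) : ℝ) * M + 1)) := by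
          rw [hη]; ring
      _ ≤ ε * 1 := by
          refine mul_le_mul_of_nonneg_left ?_ hε.le
          rw [div_le_one hden]; linarith
      _ = ε := mul_one ε
  · -- the gain
    have hcell_gain : ∀ κ : d → Fin m,
        g (sel (corner frame0 m (gridIdx κ))) - ε / 4 ≤ ∫ y, ‖Packet.field (Q (gridIdx κ)) y‖ ^ 2 := fun κ =>
      hPk_gain _
    -- `∫ ‖W‖² = Σ_κ m^{-d} ∫ ‖Q_κ‖²`
    rw [hW, integral_sq_gridField hm hQsupp]
    -- the defect as a sum over cells
    have hdef : defect e w = ∑ κ : d → Fin m, ∫ y in Torus.latticeCell m (gridIdx κ), g (Torus.proj y) :=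
      integral_eq_sum_cells hm hgc
    have hvol : ∀ κ : d → Fin m, volume.real (Torus.latticeCell m (gridIdx κ)) = ((m : ℝ)⁻¹) ^ Fintype.card d := fun κ => by
      rw [measureReal_def, Torus.volume_latticeCell hm, ENNReal.toReal_pow, ENNReal.toReal_ofReal (inv_nonneg.2 hm'.le)]
    have hcell_def : ∀ κ : d → Fin m, ∫ y in Torus.latticeCell m (gridIdx κ), g (Torus.proj y) ≤
        ((m : ℝ)⁻¹) ^ Fintype.card d * (g (sel (corner frame0 m (gridIdx κ))) + ε / 4) := by
      intro κ
      have hint : IntegrableOn (fun y => g (Torus.proj y)) (Torus.latticeCell m (gridIdx κ)) volume :=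
        (Torus.integrableOn_unitCube_of_continuous (hgc.comp Torus.continuous_proj)).mono_set
          (Torus.latticeCell_subset_unitCube hm κ)
      calc ∫ y in Torus.latticeCell m (gridIdx κ), g (Torus.proj y)
          ≤ ∫ y in Torus.latticeCell m (gridIdx κ), (g (sel (corner frame0 m (gridIdx κ))) + ε / 4) := by
            refine setIntegral_mono_on hint (integrableOn_const (Torus.volume_latticeCell_ne_top hm))
              Torus.measurableSet_latticeCell fun y hy => ?_
            have := (hcellO κ y hy).2.2
            linarith [(abs_lt.1 this).2]
        _ = ((m : ℝ)⁻¹) ^ Fintype.card d * (g (sel (corner frame0 m (gridIdx κ))) + ε / 4) := by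
            rw [setIntegral_const, hvol, smul_eq_mul]
    have hcount : ∑ _κ : d → Fin m, ((m : ℝ)⁻¹) ^ Fintype.card d = 1 := by
      rw [Finset.sum_const, Finset.card_univ, Fintype.card_fun, Fintype.card_fin, nsmul_eq_mul, Nat.cast_pow, inv_pow,
        mul_inv_cancel₀ (pow_ne_zero _ hm'.ne')]
    calc defect e w - ε ≤ (∑ κ : d → Fin m, ((m : ℝ)⁻¹) ^ Fintype.card d * (g (sel (corner frame0 m (gridIdx κ))) + ε / 4)) - ε := by
          rw [hdef]; gcongr with κ; exact hcell_def κ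
      _ = (∑ κ : d → Fin m, ((m : ℝ)⁻¹) ^ Fintype.card d * (g (sel (corner frame0 m (gridIdx κ))) - ε / 4)) - ε / 2 := by
          have : ∀ κ : d → Fin m, ((m : ℝ)⁻¹) ^ Fintype.card d * (g (sel (corner frame0 m (gridIdx κ))) + ε / 4) =
              ((m : ℝ)⁻¹) ^ Fintype.card d * (g (sel (corner frame0 m (gridIdx κ))) - ε / 4) +
                ((m : ℝ)⁻¹) ^ Fintype.card d * (ε / 2) := fun κ => by ring
          simp_rw [this, Finset.sum_add_distrib, ← Finset.sum_mul, hcount]; ring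
      _ ≤ ∑ κ : d → Fin m, ((m : ℝ)⁻¹) ^ Fintype.card d * ∫ y, ‖Packet.field (Q (gridIdx κ)) y‖ ^ 2 := by
          have : ∑ κ : d → Fin m, ((m : ℝ)⁻¹) ^ Fintype.card d * (g (sel (corner frame0 m (gridIdx κ))) - ε / 4) ≤
              ∑ κ : d → Fin m, ((m : ℝ)⁻¹) ^ Fintype.card d * ∫ y, ‖Packet.field (Q (gridIdx κ)) y‖ ^ 2 :=
            Finset.sum_le_sum fun κ _ => mul_le_mul_of_nonneg_left (hcell_gain κ) (by positivity)
          linarith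

end ForcedFlows

end Summit.AnomalousDissipation.AnomalousDissipation.Theorems
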